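import Summits.AtomisticToContinuum.BoseEinsteinCondensation.Theorems.SoloInformedConfinementCriterion

/-!
# Short-range (Bijl–Dingle–Jastrow) correlations never destroy the condensate:
# an envelope criterion and BEC for the Jastrow class, uniformly in the volume

Soloist seat `solo-AtomisticToContinuum-informed` (family hilbert6), session s6, conjunct
`BoseEinsteinCondensation` of `AtomisticToContinuum`. Companion of
`SoloInformedConfinementCriterion.lean` (two-sided confinement criterion for the zero mode).

## Content (all proved, standard axioms)

Write `Ψ(x, Y)` for an `N = n+1`-body wave function with particle `1` at `x ∈ ℝ³` and the others
at `Y ∈ (ℝ³)ⁿ`, `Λ_L = (0,L)³`, `φ₀ = L^{-3/2} 1_{Λ_L}` the flat (zero-momentum) mode and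
`N₀(Ψ) = ⟨φ₀, γ_Ψ φ₀⟩ = N ∫ |∫ φ₀ Ψ(·,Y)|² dY` its occupation (`occupation`, LSSY 2005 (1.17)).

* `SoloInformed.sq_lintegral_ge_of_envelope` — abstract **envelope inequality**: if
  `0 ≤ g ≤ M` on a set `B` and `∫_B g ≥ θ M |B|` (the function fills a fraction `θ` of its
  envelope box) then `(∫_B g)² ≥ θ |B| ∫_B g²` (reverse Hölder `L¹` vs `L²` from an `L^∞`
  envelope; one line: `∫ g² ≤ M ∫ g`).
* `SoloInformed.flatOccupation_ge_of_envelope` — **envelope criterion for the zero mode**: if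
  `Ψ ≥ 0` and on a measurable set `G` of environments `Y` the slice `x ↦ Ψ(x,Y)` is bounded by
  `M(Y)` on `Λ_L` and has `∫_{Λ_L} Ψ(·,Y) ≥ θ M(Y) L³`, then
  `N₀(Ψ) ≥ N θ ∫_G ∫_{Λ_L} Ψ(x,Y)² dx dY`; for `Ψ` normalised and supported in `Λ_L^N` and
  `G` of `Ψ²`-probability `≥ p` this is `N₀ ≥ θ p N`.
* `SoloInformed.one_sub_sum_le_prod` — Weierstrass' product inequality
  `∏ tᵢ ≥ 1 - ∑ (1 - tᵢ)` for `tᵢ ∈ [0,1]`.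
* `SoloInformed.lintegral_box_jastrowSlice_ge` — the **excluded-volume bound**: for measurable
  `0 ≤ h ≤ 1` (one-body plateau factor) and `0 ≤ f ≤ 1` (pair factor),
  `∫_{Λ_L} h(x) ∏ⱼ f(x - yⱼ) dx ≥ L³ - ∫_{Λ_L}(1-h) - n ∫_{ℝ³}(1-f)` for EVERY `Y = (y₁,…,yₙ)`.
* `SoloInformed.flatOccupation_jastrow_ge` — **BEC for the Jastrow class, all `N`, all `L`**:
  if `|Ψ(x,Y)| = F(Y) h(x) ∏ⱼ f(x - yⱼ)` on `Λ_L` with `F ≥ 0` arbitrary (it carries all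
  correlations among the other particles), then
  `N₀(Ψ) ≥ N · (L³ - ∫_{Λ_L}(1-h) - n b)/L³ · ∫∫_{Λ_L} |Ψ|²`, `b = ∫_{ℝ³}(1-f)`.
  For a normalised Dirichlet state of this form (product / Bijl–Dingle–Jastrow trial states
  `∏ᵢ h(xᵢ) ∏_{i<j} f(xᵢ-xⱼ)` with a plateau `h` equal to `1` at distance `≥ s` from `∂Λ_L`):
  `N₀/N ≥ 1 - 6s/L - ρ b (N-1)/N` — macroscopic occupation of the zero mode at every density
  `ρ < 1/b`, uniformly in the thermodynamic limit, whatever the correlations `F` of the others.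

## Why it is here (the soloist report `paper/sharpest.md`, §4.7)

By the organising identity `N₀/N = E_Y[1/(1+CV²_Y)]` (`CV_Y` the coefficient of variation of the
slice over the box) ground-state BEC in the thermodynamic limit is a reverse-Hölder inequality for
the conditional wave function, uniformly in `L` — the typed missing lemma (ML-CV). This file
proves that inequality for every slice of the form (short-range Jastrow factor) × (constant in
`x`), deterministically in the environment: the two-body, short-distance structure of the dilute
gas (cores, the scattering solution `1 - a/r` truncated at any fixed range) is provably harmless,
costing at most the excluded-volume fraction `ρ b`. More generally, for ANY `Ψ ≥ 0` and any such
Jastrow slice `S_Y = h ∏ⱼ f(· - yⱼ)`, Jensen in the probability `π_Y ∝ S_Y dx` gives the exact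
factorisation `N₀/N ≥ E_Y[θ_Y /(1 + CV²_{π_Y}(Ψ(·,Y)/S_Y))]`, `θ_Y ≥ 1 - 6s/L - ρb`: what a
proof of the conjunct must control is only the relative fluctuation over the box of the QUOTIENT
of the ground-state slice by a short-range Jastrow slice — the long-range (phonon, many-body)
dressing — on a set of environments of positive probability (paper §4.7; this file is the
`CV(G) = 0` case in the kernel). Penrose–Onsager 1956 §5 estimated the He II condensate by
exactly this excluded-volume reasoning on a Jastrow/hard-sphere state; Reatto 1969 computed the
Jastrow condensate by cluster expansion. The elementary uniform lower bound is folklore-level;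
it is recorded here because no occupation lower bound uniform in the volume for a correlated
(non-product) class was in the tree.

References: [cite: LSSY2005, §1.2 (1.17)–(1.19), Thm. 2.2 (2.15)–(2.18)];
[cite: PenroseOnsager1956, §5]; L. Reatto, Phys. Rev. 183 (1969) 334.
-/

noncomputable section

open MeasureTheory Filter Set
open scoped ENNReal NNReal ComplexConjugate

namespace Summit.AtomisticToContinuum.BoseEinsteinCondensation.Theorems

open Literature.MathematicalPhysics.QuantumManyBody.BoseGas

/-! ### Abstract envelope inequality -/

section Abstract

variable {α : Type*} [MeasurableSpace α] {μ : Measure α}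

/-- **Envelope inequality** (reverse Hölder from an `L^∞` envelope). If `g ≤ M` on `B` and
`∫_B g ≥ θ · M · μ(B)`, then `θ · μ(B) · ∫_B g² ≤ (∫_B g)²`. Proof: `∫_B g² ≤ M ∫_B g`.
[folklore] -/
theorem SoloInformed.sq_lintegral_ge_of_envelope {g : α → ℝ≥0∞} (hg : Measurable g) {B : Set α}
    (hB : MeasurableSet B) {M θ : ℝ≥0∞} (hle : ∀ x ∈ B, g x ≤ M)
    (hfill : θ * M * μ B ≤ ∫⁻ x in B, g x ∂μ) :
    θ * μ B * ∫⁻ x in B, g x ^ 2 ∂μ ≤ (∫⁻ x in B, g x ∂μ) ^ 2 := by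
  have h1 : ∫⁻ x in B, g x ^ 2 ∂μ ≤ M * ∫⁻ x in B, g x ∂μ := by
    calc ∫⁻ x in B, g x ^ 2 ∂μ ≤ ∫⁻ x in B, M * g x ∂μ := by
          refine setLIntegral_mono' hB fun x hx => ?_
          rw [sq]
          exact mul_le_mul' (hle x hx) le_rfl
      _ = M * ∫⁻ x in B, g x ∂μ := lintegral_const_mul M hg
  calc θ * μ B * ∫⁻ x in B, g x ^ 2 ∂μ ≤ θ * μ B * (M * ∫⁻ x in B, g x ∂μ) :=
        mul_le_mul' le_rfl h1
    _ = θ * M * μ B * ∫⁻ x in B, g x ∂μ := by ring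
    _ ≤ (∫⁻ x in B, g x ∂μ) * ∫⁻ x in B, g x ∂μ := mul_le_mul' hfill le_rfl
    _ = (∫⁻ x in B, g x ∂μ) ^ 2 := (sq _).symm

/-- **Weierstrass' product inequality**: for `tᵢ ∈ [0, 1]`, `1 - ∑ᵢ (1 - tᵢ) ≤ ∏ᵢ tᵢ`.
[folklore] -/
theorem SoloInformed.one_sub_sum_le_prod {ι : Type*} (s : Finset ι) (t : ι → ℝ)
    (h0 : ∀ i, 0 ≤ t i) (h1 : ∀ i, t i ≤ 1) :
    1 - ∑ i ∈ s, (1 - t i) ≤ ∏ i ∈ s, t i := by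
  classical
  refine Finset.induction_on s ?_ ?_
  · simp
  · intro a s ha ih
    rw [Finset.sum_insert ha, Finset.prod_insert ha]
    have hP0 : 0 ≤ ∏ i ∈ s, t i := Finset.prod_nonneg fun i _ => h0 i
    have hP1 : ∏ i ∈ s, t i ≤ 1 := Finset.prod_le_one (fun i _ => h0 i) fun i _ => h1 i
    nlinarith [mul_nonneg (sub_nonneg.2 (h1 a)) (sub_nonneg.2 hP1), h0 a]

end Abstract

/-! ### The envelope criterion for the zero mode -/

variable {n : ℕ}

/-- **Envelope criterion for zero-momentum occupation.** Let `Ψ ≥ 0` pointwise (as a real-valued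
complex function), measurable, with integrable slices on `Λ_L`, `L > 0`. Suppose that for every
environment `Y` in a measurable set `G` the slice is dominated by an envelope, `Ψ(x,Y) ≤ M(Y)` for
`x ∈ Λ_L`, and fills a fraction `θ` of it, `∫_{Λ_L} Ψ(x,Y) dx ≥ θ · M(Y) · L³`. Then
`⟨φ₀, γ_Ψ φ₀⟩ ≥ N · θ · ∫_G ∫_{Λ_L} Ψ(x,Y)² dx dY`, `φ₀ = L^{-3/2} 1_{Λ_L}`, `N = n + 1`.
For `Ψ` normalised and supported in `Λ_L^N` with `P_{Ψ²}(G) ≥ p`: `N₀ ≥ θ p N`.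
[cite: PenroseOnsager1956, §5] -/
theorem SoloInformed.flatOccupation_ge_of_envelope {Ψ : Config (n + 1) → ℂ} (hΨ : Measurable Ψ)
    (hΨ0 : ∀ Z, Ψ Z = ((‖Ψ Z‖ : ℝ) : ℂ)) {L : ℝ} (hL : 0 < L)
    (hint : ∀ Y : Config n, IntegrableOn (fun x => ‖Ψ (Matrix.vecCons x Y)‖) (box L))
    {G : Set (Config n)} (hG : MeasurableSet G) {θ : ℝ≥0∞} {M : Config n → ℝ≥0∞}
    (hle : ∀ Y ∈ G, ∀ x ∈ box L, (‖Ψ (Matrix.vecCons x Y)‖₊ : ℝ≥0∞) ≤ M Y)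
    (hfill : ∀ Y ∈ G, θ * M Y * ENNReal.ofReal (L ^ 3) ≤
      ∫⁻ x in box L, (‖Ψ (Matrix.vecCons x Y)‖₊ : ℝ≥0∞)) :
    (n + 1 : ℝ≥0∞) * (θ * ∫⁻ Y in G, ∫⁻ x in box L, (‖Ψ (Matrix.vecCons x Y)‖₊ : ℝ≥0∞) ^ 2) ≤
      occupation (n + 1)
        ((box L).indicator (fun _ => ((Real.sqrt ((L ^ 3)⁻¹) : ℝ) : ℂ))) Ψ := by
  have hmeas : MeasurableSet (box L) := by
    rw [SoloInformed.box_eq_preimage]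
    exact (PiLp.continuous_ofLp 2 _).measurable (MeasurableSet.univ_pi fun _ => measurableSet_Ioo)
  have hκ : 0 ≤ (L ^ 3)⁻¹ := inv_nonneg.2 (pow_nonneg hL.le 3)
  have hc2 : ENNReal.ofReal (Real.sqrt ((L ^ 3)⁻¹)) ^ 2 = (ENNReal.ofReal (L ^ 3))⁻¹ := by
    rw [← ENNReal.ofReal_pow (Real.sqrt_nonneg _), Real.sq_sqrt hκ,
      ENNReal.ofReal_inv_of_pos (pow_pos hL 3)]
  have hV : volume (box L) = ENNReal.ofReal (L ^ 3) := SoloInformed.volume_box hL.le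
  have hV0 : ENNReal.ofReal (L ^ 3) ≠ 0 := (ENNReal.ofReal_pos.2 (pow_pos hL 3)).ne'
  have hVt : ENNReal.ofReal (L ^ 3) ≠ ⊤ := ENNReal.ofReal_ne_top
  -- the key pointwise-in-`Y` estimate
  have key : ∀ Y ∈ G, θ * ∫⁻ x in box L, (‖Ψ (Matrix.vecCons x Y)‖₊ : ℝ≥0∞) ^ 2 ≤
      (ENNReal.ofReal (L ^ 3))⁻¹ * (∫⁻ x in box L, (‖Ψ (Matrix.vecCons x Y)‖₊ : ℝ≥0∞)) ^ 2 := by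
    intro Y hY
    have hg : Measurable fun x => (‖Ψ (Matrix.vecCons x Y)‖₊ : ℝ≥0∞) :=
      (measurable_comp_vecCons_left hΨ Y).nnnorm.coe_nnreal_ennreal
    have henv := SoloInformed.sq_lintegral_ge_of_envelope (μ := volume) hg hmeas (hle Y hY)
      (by rw [hV]; exact hfill Y hY)
    rw [hV] at henv
    calc θ * ∫⁻ x in box L, (‖Ψ (Matrix.vecCons x Y)‖₊ : ℝ≥0∞) ^ 2
        = (ENNReal.ofReal (L ^ 3))⁻¹ *
            (θ * ENNReal.ofReal (L ^ 3) * ∫⁻ x in box L, (‖Ψ (Matrix.vecCons x Y)‖₊ : ℝ≥0∞) ^ 2) := by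
          rw [show (ENNReal.ofReal (L ^ 3))⁻¹ *
              (θ * ENNReal.ofReal (L ^ 3) * ∫⁻ x in box L, (‖Ψ (Matrix.vecCons x Y)‖₊ : ℝ≥0∞) ^ 2) =
              ((ENNReal.ofReal (L ^ 3))⁻¹ * ENNReal.ofReal (L ^ 3)) *
              (θ * ∫⁻ x in box L, (‖Ψ (Matrix.vecCons x Y)‖₊ : ℝ≥0∞) ^ 2) by ring,
            ENNReal.inv_mul_cancel hV0 hVt, one_mul]
      _ ≤ (ENNReal.ofReal (L ^ 3))⁻¹ * (∫⁻ x in box L, (‖Ψ (Matrix.vecCons x Y)‖₊ : ℝ≥0∞)) ^ 2 :=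
          mul_le_mul' le_rfl henv
  rw [occupation]
  refine mul_le_mul' le_rfl ?_
  calc θ * ∫⁻ Y in G, ∫⁻ x in box L, (‖Ψ (Matrix.vecCons x Y)‖₊ : ℝ≥0∞) ^ 2
      ≤ ∫⁻ Y in G, θ * ∫⁻ x in box L, (‖Ψ (Matrix.vecCons x Y)‖₊ : ℝ≥0∞) ^ 2 :=
        lintegral_const_mul_le _ _
    _ ≤ ∫⁻ Y in G, (‖∫ x, conj ((box L).indicator (fun _ => ((Real.sqrt ((L ^ 3)⁻¹) : ℝ) : ℂ)) x) *
          Ψ (Matrix.vecCons x Y)‖₊ : ℝ≥0∞) ^ 2 := by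
        refine lintegral_mono_ae ((ae_restrict_iff' hG).2 (Eventually.of_forall fun Y hY => ?_))
        rw [SoloInformed.nnnorm_flatOverlap_eq hΨ hΨ0 Y (hint Y), mul_pow, hc2]
        exact key Y hY
    _ ≤ ∫⁻ Y, (‖∫ x, conj ((box L).indicator (fun _ => ((Real.sqrt ((L ^ 3)⁻¹) : ℝ) : ℂ)) x) *
          Ψ (Matrix.vecCons x Y)‖₊ : ℝ≥0∞) ^ 2 := lintegral_mono' Measure.restrict_le_self le_rfl

/-! ### The Jastrow class -/

/-- **Excluded-volume bound for a Jastrow slice.** For measurable `0 ≤ h ≤ 1` and `0 ≤ f ≤ 1`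
and every environment `Y = (y₁, …, yₙ)`:
`L³ - ∫_{Λ_L} (1 - h) - n · ∫_{ℝ³} (1 - f) ≤ ∫_{Λ_L} h(x) ∏ⱼ f(x - yⱼ) dx`
(Weierstrass' inequality pointwise, then translation invariance of Lebesgue measure).
[cite: LSSY2005, Thm. 2.2 (2.22)–(2.26)] -/
theorem SoloInformed.lintegral_box_jastrowSlice_ge {h : Space → ℝ} (hh : Measurable h)
    (hh0 : ∀ x, 0 ≤ h x) (hh1 : ∀ x, h x ≤ 1) {f : Space → ℝ} (hf : Measurable f)
    (hf0 : ∀ z, 0 ≤ f z) (hf1 : ∀ z, f z ≤ 1) {L : ℝ} (hL : 0 < L) (Y : Config n) :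
    ENNReal.ofReal (L ^ 3) - (∫⁻ x in box L, ENNReal.ofReal (1 - h x)) -
        n * ∫⁻ z, ENNReal.ofReal (1 - f z) ≤
      ∫⁻ x in box L, ENNReal.ofReal (h x * ∏ j, f (x - Y j)) := by
  have hmeas : MeasurableSet (box L) := by
    rw [SoloInformed.box_eq_preimage]
    exact (PiLp.continuous_ofLp 2 _).measurable (MeasurableSet.univ_pi fun _ => measurableSet_Ioo)
  have hV : volume (box L) = ENNReal.ofReal (L ^ 3) := SoloInformed.volume_box hL.le
  -- pointwise Weierstrass inequality, cast to `ℝ≥0∞`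
  have hpt : ∀ x, (1 : ℝ≥0∞) ≤ ENNReal.ofReal (h x * ∏ j, f (x - Y j)) +
      ENNReal.ofReal (1 - h x) + ∑ j, ENNReal.ofReal (1 - f (x - Y j)) := by
    intro x
    have hP0 : 0 ≤ ∏ j, f (x - Y j) := Finset.prod_nonneg fun j _ => hf0 _
    have hP1 : ∏ j, f (x - Y j) ≤ 1 := Finset.prod_le_one (fun j _ => hf0 _) fun j _ => hf1 _
    have hW : 1 - ∑ j, (1 - f (x - Y j)) ≤ ∏ j, f (x - Y j) :=
      SoloInformed.one_sub_sum_le_prod Finset.univ (fun j => f (x - Y j)) (fun j => hf0 _)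
        fun j => hf1 _
    have hS0 : 0 ≤ ∑ j, (1 - f (x - Y j)) := Finset.sum_nonneg fun j _ => sub_nonneg.2 (hf1 _)
    have hreal : (1 : ℝ) ≤ h x * ∏ j, f (x - Y j) + (1 - h x) + ∑ j, (1 - f (x - Y j)) := by
      nlinarith [mul_nonneg (sub_nonneg.2 (hh1 x)) (sub_nonneg.2 hP1), hh0 x]
    calc (1 : ℝ≥0∞) = ENNReal.ofReal 1 := ENNReal.ofReal_one.symm
      _ ≤ ENNReal.ofReal (h x * ∏ j, f (x - Y j) + (1 - h x) + ∑ j, (1 - f (x - Y j))) :=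
          ENNReal.ofReal_le_ofReal hreal
      _ = ENNReal.ofReal (h x * ∏ j, f (x - Y j)) + ENNReal.ofReal (1 - h x) +
            ∑ j, ENNReal.ofReal (1 - f (x - Y j)) := by
          rw [ENNReal.ofReal_add (add_nonneg (mul_nonneg (hh0 x) hP0) (sub_nonneg.2 (hh1 x))) hS0,
            ENNReal.ofReal_add (mul_nonneg (hh0 x) hP0) (sub_nonneg.2 (hh1 x)),
            ENNReal.ofReal_sum_of_nonneg fun j _ => sub_nonneg.2 (hf1 _)]
  -- measurability of the three pieces
  have hmP : Measurable fun x => ENNReal.ofReal (h x * ∏ j, f (x - Y j)) :=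
    (hh.mul (Finset.measurable_prod _ fun j _ => hf.comp (measurable_id.sub_const (Y j)))).ennreal_ofReal
  have hmh : Measurable fun x => ENNReal.ofReal (1 - h x) := (measurable_const.sub hh).ennreal_ofReal
  have hmf : ∀ j, Measurable fun x => ENNReal.ofReal (1 - f (x - Y j)) := fun j =>
    (measurable_const.sub (hf.comp (measurable_id.sub_const (Y j)))).ennreal_ofReal
  -- integrate over the box
  have hint : ENNReal.ofReal (L ^ 3) ≤ (∫⁻ x in box L, ENNReal.ofReal (h x * ∏ j, f (x - Y j))) +
      (∫⁻ x in box L, ENNReal.ofReal (1 - h x)) +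
      ∑ j, ∫⁻ x in box L, ENNReal.ofReal (1 - f (x - Y j)) := by
    calc ENNReal.ofReal (L ^ 3) = ∫⁻ _ in box L, (1 : ℝ≥0∞) := by
          rw [setLIntegral_one, hV]
      _ ≤ ∫⁻ x in box L, (ENNReal.ofReal (h x * ∏ j, f (x - Y j)) +
            ENNReal.ofReal (1 - h x) + ∑ j, ENNReal.ofReal (1 - f (x - Y j))) :=
          lintegral_mono fun x => hpt x
      _ = (∫⁻ x in box L, ENNReal.ofReal (h x * ∏ j, f (x - Y j))) +
            (∫⁻ x in box L, ENNReal.ofReal (1 - h x)) +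
            ∫⁻ x in box L, ∑ j, ENNReal.ofReal (1 - f (x - Y j)) := by
          have hm2 : Measurable fun x => ENNReal.ofReal (h x * ∏ j, f (x - Y j)) +
              ENNReal.ofReal (1 - h x) := hmP.add hmh
          rw [lintegral_add_left hm2, lintegral_add_left hmP]
      _ = (∫⁻ x in box L, ENNReal.ofReal (h x * ∏ j, f (x - Y j))) +
            (∫⁻ x in box L, ENNReal.ofReal (1 - h x)) +
            ∑ j, ∫⁻ x in box L, ENNReal.ofReal (1 - f (x - Y j)) := by
          rw [lintegral_finsetSum _ fun j _ => hmf j]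
  -- each excluded volume is at most `b = ∫ (1 - f)` (enlarge the box to `ℝ³`, translate)
  have hb : ∑ j, ∫⁻ x in box L, ENNReal.ofReal (1 - f (x - Y j)) ≤
      n * ∫⁻ z, ENNReal.ofReal (1 - f z) := by
    calc ∑ j, ∫⁻ x in box L, ENNReal.ofReal (1 - f (x - Y j))
        ≤ ∑ j : Fin n, ∫⁻ z, ENNReal.ofReal (1 - f z) := by
          refine Finset.sum_le_sum fun j _ => ?_
          calc ∫⁻ x in box L, ENNReal.ofReal (1 - f (x - Y j))
              ≤ ∫⁻ x, ENNReal.ofReal (1 - f (x - Y j)) := lintegral_mono' Measure.restrict_le_self le_rfl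
            _ = ∫⁻ z, ENNReal.ofReal (1 - f z) :=
                lintegral_sub_right_eq_self (fun z => ENNReal.ofReal (1 - f z)) (Y j)
      _ = n * ∫⁻ z, ENNReal.ofReal (1 - f z) := by
          rw [Finset.sum_const, Finset.card_univ, Fintype.card_fin, nsmul_eq_mul]
  rw [tsub_le_iff_right, tsub_le_iff_right]
  calc ENNReal.ofReal (L ^ 3)
      ≤ (∫⁻ x in box L, ENNReal.ofReal (h x * ∏ j, f (x - Y j))) +
          (∫⁻ x in box L, ENNReal.ofReal (1 - h x)) +
          ∑ j, ∫⁻ x in box L, ENNReal.ofReal (1 - f (x - Y j)) := hint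
    _ ≤ (∫⁻ x in box L, ENNReal.ofReal (h x * ∏ j, f (x - Y j))) +
          (∫⁻ x in box L, ENNReal.ofReal (1 - h x)) + n * ∫⁻ z, ENNReal.ofReal (1 - f z) :=
        add_le_add le_rfl hb
    _ = (∫⁻ x in box L, ENNReal.ofReal (h x * ∏ j, f (x - Y j))) +
          n * (∫⁻ z, ENNReal.ofReal (1 - f z)) + ∫⁻ x in box L, ENNReal.ofReal (1 - h x) := by
        ring

/-- **Bose–Einstein condensation for the Jastrow class, uniformly in the volume.** Let
`Ψ ≥ 0` be measurable with integrable slices on `Λ_L`, `L > 0`, and suppose that on the box its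
slices have the Bijl–Dingle–Jastrow form `|Ψ(x,Y)| = F(Y) · h(x) · ∏ⱼ f(x - yⱼ)` with `F ≥ 0`
arbitrary (all correlations among the other particles), a one-body factor `0 ≤ h ≤ 1` and a pair
factor `0 ≤ f ≤ 1`, both measurable. Then, with `b = ∫_{ℝ³}(1 - f)` and `c_h = ∫_{Λ_L}(1 - h)`,
`⟨φ₀, γ_Ψ φ₀⟩ ≥ N · (L³ - c_h - n b)/L³ · ∫_{(ℝ³)ⁿ} ∫_{Λ_L} |Ψ(x,Y)|² dx dY`.
For a normalised state supported in `Λ_L^N` (e.g. the trial states `∏ᵢ h(xᵢ) ∏_{i<j} f(xᵢ-xⱼ)`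
with `f = 1` outside a finite range and `h` a plateau equal to `1` at distance `≥ s` from the
boundary, `c_h ≤ 6 s L²`) this reads `N₀/N ≥ 1 - 6s/L - ρ b (N-1)/N`, `ρ = N/L³`: a macroscopic
zero-momentum occupation at every density `ρ < 1/b`, for all `N` and `L`, independently of `F`.
[cite: PenroseOnsager1956, §5] [cite: LSSY2005, Thm. 2.2 (2.15)–(2.18)] -/
theorem SoloInformed.flatOccupation_jastrow_ge {Ψ : Config (n + 1) → ℂ} (hΨ : Measurable Ψ)
    (hΨ0 : ∀ Z, Ψ Z = ((‖Ψ Z‖ : ℝ) : ℂ)) {L : ℝ} (hL : 0 < L)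
    (hint : ∀ Y : Config n, IntegrableOn (fun x => ‖Ψ (Matrix.vecCons x Y)‖) (box L))
    {F : Config n → ℝ} (hF : ∀ Y, 0 ≤ F Y) {h : Space → ℝ} (hh : Measurable h)
    (hh0 : ∀ x, 0 ≤ h x) (hh1 : ∀ x, h x ≤ 1) {f : Space → ℝ} (hf : Measurable f)
    (hf0 : ∀ z, 0 ≤ f z) (hf1 : ∀ z, f z ≤ 1)
    (hJ : ∀ Y, ∀ x ∈ box L, ‖Ψ (Matrix.vecCons x Y)‖ = F Y * (h x * ∏ j, f (x - Y j))) :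
    (n + 1 : ℝ≥0∞) *
        ((ENNReal.ofReal (L ^ 3) - (∫⁻ x in box L, ENNReal.ofReal (1 - h x)) -
            n * ∫⁻ z, ENNReal.ofReal (1 - f z)) * (ENNReal.ofReal (L ^ 3))⁻¹ *
          ∫⁻ Y, ∫⁻ x in box L, (‖Ψ (Matrix.vecCons x Y)‖₊ : ℝ≥0∞) ^ 2) ≤
      occupation (n + 1)
        ((box L).indicator (fun _ => ((Real.sqrt ((L ^ 3)⁻¹) : ℝ) : ℂ))) Ψ := by
  have hmeas : MeasurableSet (box L) := by
    rw [SoloInformed.box_eq_preimage]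
    exact (PiLp.continuous_ofLp 2 _).measurable (MeasurableSet.univ_pi fun _ => measurableSet_Ioo)
  have hV0 : ENNReal.ofReal (L ^ 3) ≠ 0 := (ENNReal.ofReal_pos.2 (pow_pos hL 3)).ne'
  have hVt : ENNReal.ofReal (L ^ 3) ≠ ⊤ := ENNReal.ofReal_ne_top
  set V : ℝ≥0∞ := ENNReal.ofReal (L ^ 3) with hVdef
  set D : ℝ≥0∞ := V - (∫⁻ x in box L, ENNReal.ofReal (1 - h x)) -
    n * ∫⁻ z, ENNReal.ofReal (1 - f z) with hDdef
  -- slices in `ℝ≥0∞`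
  have hslice : ∀ Y : Config n, ∀ x ∈ box L, (‖Ψ (Matrix.vecCons x Y)‖₊ : ℝ≥0∞) =
      ENNReal.ofReal (F Y) * ENNReal.ofReal (h x * ∏ j, f (x - Y j)) := by
    intro Y x hx
    rw [SoloInformed.coe_nnnorm_eq_ofReal_norm, hJ Y x hx, ENNReal.ofReal_mul (hF Y)]
  have hP1 : ∀ (Y : Config n) (x : Space), h x * ∏ j, f (x - Y j) ≤ 1 := by
    intro Y x
    have hP1 : ∏ j, f (x - Y j) ≤ 1 := Finset.prod_le_one (fun j _ => hf0 _) fun j _ => hf1 _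
    calc h x * ∏ j, f (x - Y j) ≤ h x * 1 := mul_le_mul_of_nonneg_left hP1 (hh0 x)
      _ ≤ 1 := by rw [mul_one]; exact hh1 x
  have hmP : ∀ Y : Config n, Measurable fun x => ENNReal.ofReal (h x * ∏ j, f (x - Y j)) :=
    fun Y => (hh.mul (Finset.measurable_prod _ fun j _ =>
      hf.comp (measurable_id.sub_const (Y j)))).ennreal_ofReal
  have hle : ∀ Y ∈ (univ : Set (Config n)), ∀ x ∈ box L,
      (‖Ψ (Matrix.vecCons x Y)‖₊ : ℝ≥0∞) ≤ ENNReal.ofReal (F Y) := by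
    intro Y _ x hx
    rw [hslice Y x hx]
    calc ENNReal.ofReal (F Y) * ENNReal.ofReal (h x * ∏ j, f (x - Y j))
        ≤ ENNReal.ofReal (F Y) * 1 := by
          refine mul_le_mul' le_rfl ?_
          rw [← ENNReal.ofReal_one]
          exact ENNReal.ofReal_le_ofReal (hP1 Y x)
      _ = ENNReal.ofReal (F Y) := mul_one _
  have hfill : ∀ Y ∈ (univ : Set (Config n)),
      D * V⁻¹ * ENNReal.ofReal (F Y) * V ≤ ∫⁻ x in box L, (‖Ψ (Matrix.vecCons x Y)‖₊ : ℝ≥0∞) := by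
    intro Y _
    calc D * V⁻¹ * ENNReal.ofReal (F Y) * V = (V⁻¹ * V) * (ENNReal.ofReal (F Y) * D) := by ring
      _ = ENNReal.ofReal (F Y) * D := by rw [ENNReal.inv_mul_cancel hV0 hVt, one_mul]
      _ ≤ ENNReal.ofReal (F Y) * ∫⁻ x in box L, ENNReal.ofReal (h x * ∏ j, f (x - Y j)) :=
          mul_le_mul' le_rfl (SoloInformed.lintegral_box_jastrowSlice_ge hh hh0 hh1 hf hf0 hf1 hL Y)
      _ = ∫⁻ x in box L, ENNReal.ofReal (F Y) * ENNReal.ofReal (h x * ∏ j, f (x - Y j)) :=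
          (lintegral_const_mul _ (hmP Y)).symm
      _ = ∫⁻ x in box L, (‖Ψ (Matrix.vecCons x Y)‖₊ : ℝ≥0∞) :=
          setLIntegral_congr_fun hmeas fun x hx => (hslice Y x hx).symm
  have henv := SoloInformed.flatOccupation_ge_of_envelope hΨ hΨ0 hL hint MeasurableSet.univ
    (θ := D * V⁻¹) (M := fun Y => ENNReal.ofReal (F Y)) hle hfill
  rw [Measure.restrict_univ] at henv
  exact henv

end Summit.AtomisticToContinuum.BoseEinsteinCondensation.Theorems

end
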